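import Summits.CriticalPhenomena.PercolationContinuityZ3.Theorems.Transplant.FKDoubleFanMultifanCellAA2
import Summits.CriticalPhenomena.PercolationContinuityZ3.Theorems.Transplant.FKDoubleFanMultifanCellAAC2
import Summits.CriticalPhenomena.PercolationContinuityZ3.Theorems.Transplant.FKDoubleFanMultifanCellABD2
import Summits.CriticalPhenomena.PercolationContinuityZ3.Theorems.Transplant.FKDoubleFanMultifanCellACAC2
import Summits.CriticalPhenomena.PercolationContinuityZ3.Theorems.Transplant.FKDoubleFanMultifanCellACBD2
import Summits.CriticalPhenomena.PercolationContinuityZ3.Theorems.Transplant.FKDoubleFanMultifanCellACOne2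
import Summits.CriticalPhenomena.PercolationContinuityZ3.Theorems.Transplant.FKDoubleFanMultifanCellACR2
import Summits.CriticalPhenomena.PercolationContinuityZ3.Theorems.Transplant.FKDoubleFanMultifanCellAD2
import Summits.CriticalPhenomena.PercolationContinuityZ3.Theorems.Transplant.FKDoubleFanMultifanCellAOne2
import Summits.CriticalPhenomena.PercolationContinuityZ3.Theorems.Transplant.FKDoubleFanMultifanCellAR2
import Summits.CriticalPhenomena.PercolationContinuityZ3.Theorems.Transplant.FKDoubleFanMultifanCellBDBD2
import Summits.CriticalPhenomena.PercolationContinuityZ3.Theorems.Transplant.FKDoubleFanMultifanCellBDOne2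
import Summits.CriticalPhenomena.PercolationContinuityZ3.Theorems.Transplant.FKDoubleFanMultifanCellBDR2
import Summits.CriticalPhenomena.PercolationContinuityZ3.Theorems.Transplant.FKDoubleFanMultifanCellDAC2
import Summits.CriticalPhenomena.PercolationContinuityZ3.Theorems.Transplant.FKDoubleFanMultifanCellDBD2
import Summits.CriticalPhenomena.PercolationContinuityZ3.Theorems.Transplant.FKDoubleFanMultifanCellDD2
import Summits.CriticalPhenomena.PercolationContinuityZ3.Theorems.Transplant.FKDoubleFanMultifanCellDOne2
import Summits.CriticalPhenomena.PercolationContinuityZ3.Theorems.Transplant.FKDoubleFanMultifanCellDR2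
import Summits.CriticalPhenomena.PercolationContinuityZ3.Theorems.Transplant.FKDoubleFanMultifanCellOneOne2
import Summits.CriticalPhenomena.PercolationContinuityZ3.Theorems.Transplant.FKDoubleFanMultifanCellOneR2
import Summits.CriticalPhenomena.PercolationContinuityZ3.Theorems.Transplant.FKDoubleFanMultifanCellRR2
import HarnessLib

/-!
# Double fans `K₂ ∨ P_{m+1}`: MULTIFAN₁ cross-apex negative correlation at EVERY distance, UNCONDITIONALLY (LEMMA‴ proved)

Helper file (`--supports stmt-CriticalPhenomena-4575`), FK sub-lane `prim-bschramm-fk-3` (gen 35); builds on p205010 (kernel theorem, internal audit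
signed; external expert review pending).  No named facts, no sorries; standard axioms.  Memo `bschramm/prim-bschramm-fk-3/FAR-CROSS-X.md`.

ASSEMBLY of LEMMA‴ (`mfZ¹⁰mfZ⁰¹ − mfZ¹¹mfZ⁰⁰ ≥ 0` on `InKE⁴`, `0 < q ≤ 1`):
* `…MultifanForm`, `…MultifanGens`, `…MultifanGood`: the four-leg Rayleigh difference is `q²·pairH(target, input)`, affine along the four apex
  fibres, and at the endpoint shapes of the two fan legs a pairing of non-negative combinations of six generator bivectors; hence LEMMA‴ follows from
  `GoodIJ q P S` at the 36 pairs of endpoint product vectors (`mfRay_nonneg_inKE_of_goodIJ`);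
* `…MultifanCell*`: `GoodIJ` at the 21 pairs `P ≤ S` — 756 elementary cells, each an exact polynomial identity against certified factors
  (`…MultifanFac*`: tensor-Bernstein certificates, three closed-form SOS, one `t = s/(1−s)` substitution) and the four kernel polynomials CORE
  (`coreStruct_nonneg`, gen 33), 𝒞₁, 𝒞₂ (`mfCone_nonneg`, `mfCtwo_nonneg`, gen 34) and CORE4 (`core4_nonneg`, gen 34's piecewise certificate);
  the remaining 15 pairs by the mirror symmetry `GoodIJ.symm`.
CONSEQUENCE (**`negCorr_spokes_cross_far_multifan`**, from `negCorr_spokes_cross_far_of_multifan` of `…DoubleFanMultifan`): for every weighted double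
fan `K₂ ∨ P_{m+1}` (`card V = m+3`, weights supported on the double-fan pairs), every `0 < q ≤ 1` and all `j ≤ ℓ < k ≤ m` such that the middle
`b`-spokes `b c_i`, `j < i ≤ ℓ`, and the middle `a`-spokes `a c_i`, `ℓ < i < k`, carry weight `0` (every middle `a`-spoke precedes every middle
`b`-spoke — MULTIFAN₁), the far cross-apex pair is negatively correlated:  `φ(J_{a c_j} ∩ J_{b c_k}) ≤ φ(J_{a c_j})·φ(J_{b c_k})`.
This contains the one-sided theorem of gen 33 (`ℓ = j` or `ℓ = k−1`) and is the first genuinely TWO-SIDED family at every distance.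
[cite: Grimmett2006, §3.9 eq. (3.94) (pp. 63–64)] [folklore]
-/

noncomputable section

namespace Summit.CriticalPhenomena.PercolationContinuityZ3.Theorems

namespace FK

namespace ThreeApex

/-- **`GoodIJ` at all 36 endpoint pairs** (`0 ≤ q ≤ 1`): the 21 pairs `P ≤ S` from `…MultifanCell*`, the rest by `GoodIJ.symm`. [folklore] -/
theorem goodIJ_endpoints {q : ℝ} (hq0 : 0 ≤ q) (hq1 : q ≤ 1) : ∀ P S : P6, IsEndP q P → IsEndP q S → GoodIJ q P S := by
  rintro P S hP hS
  rcases hP with rfl | rfl | rfl | rfl | rfl | ⟨tu, wu, htu, hwu0, hwu1, rfl⟩ <;>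
    rcases hS with rfl | rfl | rfl | rfl | rfl | ⟨ts, ws, hts, hws0, hws1, rfl⟩
  · exact goodIJ_A_A hq0 hq1
  · exact goodIJ_A_D hq0 hq1
  · exact goodIJ_A_AC hq0 hq1
  · exact goodIJ_A_BD hq0 hq1
  · exact goodIJ_A_One hq0 hq1
  · exact goodIJ_A_R hq0 hq1 hts hws0 hws1
  · exact (goodIJ_A_D hq0 hq1).symm
  · exact goodIJ_D_D hq0 hq1
  · exact goodIJ_D_AC hq0 hq1
  · exact goodIJ_D_BD hq0 hq1
  · exact goodIJ_D_One hq0 hq1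
  · exact goodIJ_D_R hq0 hq1 hts hws0 hws1
  · exact (goodIJ_A_AC hq0 hq1).symm
  · exact (goodIJ_D_AC hq0 hq1).symm
  · exact goodIJ_AC_AC hq0 hq1
  · exact goodIJ_AC_BD hq0 hq1
  · exact goodIJ_AC_One hq0 hq1
  · exact goodIJ_AC_R hq0 hq1 hts hws0 hws1
  · exact (goodIJ_A_BD hq0 hq1).symm
  · exact (goodIJ_D_BD hq0 hq1).symm
  · exact (goodIJ_AC_BD hq0 hq1).symm
  · exact goodIJ_BD_BD hq0 hq1
  · exact goodIJ_BD_One hq0 hq1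
  · exact goodIJ_BD_R hq0 hq1 hts hws0 hws1
  · exact (goodIJ_A_One hq0 hq1).symm
  · exact (goodIJ_D_One hq0 hq1).symm
  · exact (goodIJ_AC_One hq0 hq1).symm
  · exact (goodIJ_BD_One hq0 hq1).symm
  · exact goodIJ_One_One hq0 hq1
  · exact goodIJ_One_R hq0 hq1 hts hws0 hws1
  · exact (goodIJ_A_R hq0 hq1 htu hwu0 hwu1).symm
  · exact (goodIJ_D_R hq0 hq1 htu hwu0 hwu1).symm
  · exact (goodIJ_AC_R hq0 hq1 htu hwu0 hwu1).symm
  · exact (goodIJ_BD_R hq0 hq1 htu hwu0 hwu1).symm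
  · exact (goodIJ_One_R hq0 hq1 htu hwu0 hwu1).symm
  · exact goodIJ_R_R hq0 hq1 htu hwu0 hwu1 hts hws0 hws1

/-- **LEMMA‴** (the four-leg inequality of `…DoubleFanMultifan`): `mfZ¹⁰·mfZ⁰¹ − mfZ¹¹·mfZ⁰⁰ ≥ 0` for all `F, G, u, s ∈ InKE q`, `0 < q ≤ 1`. [folklore] -/
theorem mfRay_nonneg_inKE {q : ℝ} (hq0 : 0 < q) (hq1 : q ≤ 1) (F G u s : V5) (hF : InKE q F) (hG : InKE q G) (hu : InKE q u)
    (hs : InKE q s) : 0 ≤ mfZ q F G u s 1 0 * mfZ q F G u s 0 1 - mfZ q F G u s 1 1 * mfZ q F G u s 0 0 :=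
  mfRay_nonneg_inKE_of_goodIJ hq0 hq1 (fun _ => goodIJ_endpoints hq0.le hq1) F G u s hF hG hu hs

open MeasureTheory Literature.Probability.LatticeModels Literature.Probability.Percolation
open scoped Classical

variable {V : Type*} [Fintype V]
variable {a b : V} {c : ℕ → V} {m : ℕ}
variable (hab : a ≠ b) (hinj : ∀ j k, j ≤ m → k ≤ m → c j = c k → j = k) (hca : ∀ j, j ≤ m → c j ≠ a) (hcb : ∀ j, j ≤ m → c j ≠ b)
include hab hinj hca hcb

/-- **MULTIFAN₁ CROSS-APEX NEGATIVE CORRELATION AT EVERY DISTANCE, unconditionally.**  For every weighted double fan (`card V = m + 3`, weights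
supported on the double-fan pairs), `0 < q ≤ 1`, and all `j ≤ ℓ < k ≤ m` with `w(b c_i) = 0` for `j < i ≤ ℓ` and `w(a c_i) = 0` for `ℓ < i < k`:
`φ(J_{a c_j} ∩ J_{b c_k}) ≤ φ(J_{a c_j})·φ(J_{b c_k})`. [folklore] -/
theorem negCorr_spokes_cross_far_multifan (hcard : Fintype.card V = m + 3) {q : ℝ} (hq0 : 0 < q) (hq1 : q ≤ 1) (w : Sym2 V → unitInterval)
    (hsupp : ∀ e, e ∉ dfPairs a b c m → w e = 0) {j ℓ k : ℕ} (hjl : j ≤ ℓ) (hlk : ℓ < k) (hk : k ≤ m)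
    (hb0 : ∀ i, j < i → i ≤ ℓ → w s(b, c i) = 0) (ha0 : ∀ i, ℓ < i → i < k → w s(a, c i) = 0) :
    (rcMeasureW w q ∅).real ({ω : BondConfig V | s(a, c j) ∈ ω} ∩ {ω | s(b, c k) ∈ ω}) ≤
      (rcMeasureW w q ∅).real {ω : BondConfig V | s(a, c j) ∈ ω} * (rcMeasureW w q ∅).real {ω : BondConfig V | s(b, c k) ∈ ω} :=
  negCorr_spokes_cross_far_of_multifan hab hinj hca hcb hcard hq0 w hsupp
    (fun F G u s hF hG hu hs => mfRay_nonneg_inKE hq0 hq1 F G u s hF hG hu hs) hjl hlk hk hb0 ha0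

end ThreeApex

end FK

end Summit.CriticalPhenomena.PercolationContinuityZ3.Theorems
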